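import Mathlib.RingTheory.Valuation.ValuationSubring
import Mathlib.RingTheory.Ideal.Operations
import Mathlib.RingTheory.LocalRing.MaximalIdeal.Basic
import Mathlib.RingTheory.FiniteType
import Mathlib.RingTheory.Noetherian.Basic
import Mathlib.Algebra.Algebra.Subalgebra.Lattice
import HarnessLib

/-!
# Level calculus for adapted charts, III: lifting residual re-parametrizations (type-2 transforms)

Crux `Valuative.LuAlphaPTorsor` (stmt-ResolutionOfSingularities-0641), line `pfaff-line-log-final-forms`,
lead seat c4 — the LIFT step of the level induction S3*: after adjoining to a `W`-chart `(B₀, x_T)`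
finitely many `W`-units `u` (Laurent monomials in the lower parameters), the ideal `(x_T)` of
`B = B₀[u]` need no longer be the whole `W`-centre (torsion in the residual algebra), but every
`W`-small element of `B` is thrown into `(x_T)` by a power of the common denominator `Q` of the
`u`; by noetherianity one power `Q^{N₀}` serves all, and the TYPE-2 transform
`z_i = x_{T,i} / (Q^{N₀} E_i)` (`E_i` further `W`-units of `B`) produces a `W`-chart
`(B[z], z)` again; plus a Laurent-monomial toolkit (`ap_prod_zpow_*`, `ap_prod_split`,
`ap_exp_eq_of_prod_eq`). Registered anchor: `ap_exists_uniform_pow`. [folklore] (Zariski 1940;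
Cutkosky 2022 §4, transforms of type (2).)
-/

set_option linter.dupNamespace false

open IsLocalRing

namespace Summit.ResolutionOfSingularities.ResolutionOfSingularities.Theorems.PfaffLine

variable {k K : Type} [Field k] [Field K] [Algebra k K]

/-- **Clearing denominators in `B₀[u]`.** If `Q ∈ B₀` and `Q · u_j ∈ B₀` for all `j`, every
element of `B = k[B₀ ∪ {u_j}]` is thrown into `B₀` by a power of `Q`. [folklore] -/
theorem ap_exists_pow_mul_mem (B₀ : Subalgebra k K) {ι : Type} (u : ι → K) (Q : K) (hQ : Q ∈ B₀)
    (hQu : ∀ j, Q * u j ∈ B₀) :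
    ∀ τ : K, τ ∈ Algebra.adjoin k ((B₀ : Set K) ∪ Set.range u) → ∃ N : ℕ, Q ^ N * τ ∈ B₀ := by
  intro τ hτ
  refine Algebra.adjoin_induction (p := fun τ _ => ∃ N : ℕ, Q ^ N * τ ∈ B₀) ?_ ?_ ?_ ?_ hτ
  · rintro x (hx | ⟨j, rfl⟩)
    · exact ⟨0, by simpa using hx⟩
    · exact ⟨1, by simpa using hQu j⟩
  · intro c; exact ⟨0, by simp⟩
  · rintro x y - - ⟨N₁, h₁⟩ ⟨N₂, h₂⟩
    refine ⟨N₁ + N₂, ?_⟩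
    have : Q ^ (N₁ + N₂) * (x + y) = Q ^ N₂ * (Q ^ N₁ * x) + Q ^ N₁ * (Q ^ N₂ * y) := by ring
    rw [this]
    exact add_mem (mul_mem (pow_mem hQ _) h₁) (mul_mem (pow_mem hQ _) h₂)
  · rintro x y - - ⟨N₁, h₁⟩ ⟨N₂, h₂⟩
    refine ⟨N₁ + N₂, ?_⟩
    have : Q ^ (N₁ + N₂) * (x * y) = (Q ^ N₁ * x) * (Q ^ N₂ * y) := by ring
    rw [this]
    exact mul_mem h₁ h₂

/-- **One exponent for all.** In a noetherian ring, if every element of an ideal `I` is thrown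
into the ideal `J` by some power of `Q`, one power of `Q` throws all of `I` into `J`. [folklore] -/
theorem ap_exists_uniform_pow : ∀ {A : Type} [CommRing A] [IsNoetherianRing A] (I J : Ideal A) (Q : A), (∀ τ ∈ I, ∃ N : ℕ, Q ^ N * τ ∈ J) → ∃ N₀ : ℕ, ∀ τ ∈ I, Q ^ N₀ * τ ∈ J := by
  intro A _ _ I J Q h
  classical
  obtain ⟨s, hs⟩ := (IsNoetherian.noetherian I : I.FG)
  have hsI : ∀ g ∈ s, g ∈ I := fun g hg => hs ▸ Ideal.subset_span hg
  choose N hN using fun g : s => h g.1 (hsI g.1 g.2)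
  refine ⟨s.attach.sup N, fun τ hτ => ?_⟩
  rw [← hs] at hτ
  refine Submodule.span_induction (p := fun τ _ => Q ^ (s.attach.sup N) * τ ∈ J) ?_ ?_ ?_ ?_ hτ
  · intro g hg
    have hle : N ⟨g, hg⟩ ≤ s.attach.sup N := Finset.le_sup (Finset.mem_attach _ _)
    obtain ⟨d, hd⟩ := Nat.exists_eq_add_of_le hle
    rw [hd, pow_add, mul_comm (Q ^ _) (Q ^ d), mul_assoc]
    exact Ideal.mul_mem_left _ _ (hN ⟨g, hg⟩)
  · simp
  · intro x y _ _ hx hy; rw [mul_add]; exact add_mem hx hy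
  · intro a x _ hx; rw [smul_eq_mul, mul_left_comm]; exact Ideal.mul_mem_left _ _ hx

/-- **Elements of `B[z]` modulo `(z)`.** Every element of `k[B ∪ {z_i}]` differs from an element of
`B` by an element of the ideal generated by the `z_i`. [folklore] -/
theorem ap_exists_sub_mem_span (B : Subalgebra k K) {ι : Type} (z : ι → K)
    (R₃ : Subalgebra k K) (hR₃ : R₃ = Algebra.adjoin k ((B : Set K) ∪ Set.range z))
    (hz : ∀ i, z i ∈ R₃) :
    ∀ (τ : K) (hτ : τ ∈ R₃), ∃ (b : K) (_ : b ∈ B) (hbR : b ∈ R₃),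
      (⟨τ - b, sub_mem hτ hbR⟩ : R₃.toSubring) ∈
        Ideal.span (Set.range fun i => (⟨z i, hz i⟩ : R₃.toSubring)) := by
  have hBR : B ≤ R₃ := by rw [hR₃]; exact fun x hx => Algebra.subset_adjoin (Or.inl hx)
  intro τ hτ
  have hτ' : τ ∈ Algebra.adjoin k ((B : Set K) ∪ Set.range z) := hR₃ ▸ hτ
  -- the statement proved by induction carries its own membership proof
  suffices h : ∃ (b : K) (hb : b ∈ B) (hτR : τ ∈ R₃),
      (⟨τ - b, sub_mem hτR (hBR hb)⟩ : R₃.toSubring) ∈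
        Ideal.span (Set.range fun i => (⟨z i, hz i⟩ : R₃.toSubring)) by
    obtain ⟨b, hb, hτR, h⟩ := h
    exact ⟨b, hb, hBR hb, h⟩
  refine Algebra.adjoin_induction (p := fun τ _ => ∃ (b : K) (hb : b ∈ B) (hτR : τ ∈ R₃),
      (⟨τ - b, sub_mem hτR (hBR hb)⟩ : R₃.toSubring) ∈
        Ideal.span (Set.range fun i => (⟨z i, hz i⟩ : R₃.toSubring))) ?_ ?_ ?_ ?_ hτ'
  · rintro x (hx | ⟨i, rfl⟩)
    · refine ⟨x, hx, hBR hx, ?_⟩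
      have : (⟨x - x, sub_mem (hBR hx) (hBR hx)⟩ : R₃.toSubring) = 0 := Subtype.ext (sub_self _)
      rw [this]; exact Ideal.zero_mem _
    · refine ⟨0, B.zero_mem, hz i, ?_⟩
      have : (⟨z i - 0, sub_mem (hz i) (hBR B.zero_mem)⟩ : R₃.toSubring) = ⟨z i, hz i⟩ :=
        Subtype.ext (sub_zero _)
      rw [this]; exact Ideal.subset_span ⟨i, rfl⟩
  · intro c
    refine ⟨algebraMap k K c, B.algebraMap_mem c, R₃.algebraMap_mem c, ?_⟩
    have : (⟨algebraMap k K c - algebraMap k K c, sub_mem (R₃.algebraMap_mem c) (hBR (B.algebraMap_mem c))⟩ : R₃.toSubring) = 0 :=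
      Subtype.ext (sub_self _)
    rw [this]; exact Ideal.zero_mem _
  · rintro x y - - ⟨b₁, hb₁, hx, h₁⟩ ⟨b₂, hb₂, hy, h₂⟩
    refine ⟨b₁ + b₂, add_mem hb₁ hb₂, add_mem hx hy, ?_⟩
    have : (⟨x + y - (b₁ + b₂), sub_mem (add_mem hx hy) (hBR (add_mem hb₁ hb₂))⟩ : R₃.toSubring) =
        ⟨x - b₁, sub_mem hx (hBR hb₁)⟩ + ⟨y - b₂, sub_mem hy (hBR hb₂)⟩ :=
      Subtype.ext (by push_cast; ring)
    rw [this]; exact Ideal.add_mem _ h₁ h₂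
  · rintro x y - - ⟨b₁, hb₁, hx, h₁⟩ ⟨b₂, hb₂, hy, h₂⟩
    refine ⟨b₁ * b₂, mul_mem hb₁ hb₂, mul_mem hx hy, ?_⟩
    have : (⟨x * y - b₁ * b₂, sub_mem (mul_mem hx hy) (hBR (mul_mem hb₁ hb₂))⟩ : R₃.toSubring) =
        ⟨x, hx⟩ * ⟨y - b₂, sub_mem hy (hBR hb₂)⟩ + ⟨b₂, hBR hb₂⟩ * ⟨x - b₁, sub_mem hx (hBR hb₁)⟩ :=
      Subtype.ext (by push_cast; ring)
    rw [this]
    exact Ideal.add_mem _ (Ideal.mul_mem_left _ _ h₂) (Ideal.mul_mem_left _ _ h₁)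

/-- **The type-2 transform restores the `W`-chart.** Let `B ⊆ W` contain `x_T` and `Q`, and
suppose every `W`-small element of `B` is thrown into `(x_T)B` by `Q^{N₀}`. For `W`-units… for
non-zero `E_i ∈ B` put `z_i = x_{T,i} / (Q^{N₀} E_i)` and `R₃ = k[B ∪ {z_i}] ⊆ W`; if the `z_i`
are `W`-small then `(z) = 𝔪_W ∩ R₃`. [folklore] -/
theorem ap_span_eq_comap_type2 (W : ValuationSubring K) (B : Subalgebra k K)
    {nT : ℕ} (xT : Fin nT → K) (hxT : ∀ i, xT i ∈ B)
    (Q : K) (hQ : Q ∈ B) (hQ0 : Q ≠ 0) (N₀ : ℕ)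
    (hthrow : ∀ (τ : K) (hτ : τ ∈ B), W.valuation τ < 1 →
      (⟨Q ^ N₀ * τ, mul_mem (pow_mem hQ N₀) hτ⟩ : B.toSubring) ∈
        Ideal.span (Set.range fun i => (⟨xT i, hxT i⟩ : B.toSubring)))
    (E : Fin nT → K) (hE : ∀ i, E i ∈ B) (hE0 : ∀ i, E i ≠ 0)
    (z : Fin nT → K) (hz : ∀ i, z i = xT i / (Q ^ N₀ * E i)) (hzW : ∀ i, W.valuation (z i) < 1)
    (R₃ : Subalgebra k K) (hR₃ : R₃ = Algebra.adjoin k ((B : Set K) ∪ Set.range z))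
    (hzR : ∀ i, z i ∈ R₃) (h3W : R₃.toSubring ≤ W.toSubring) :
    Ideal.span (Set.range fun i => (⟨z i, hzR i⟩ : R₃.toSubring)) =
      Ideal.comap (Subring.inclusion h3W) (maximalIdeal W) := by
  classical
  have hBR : B ≤ R₃ := by rw [hR₃]; exact fun x hx => Algebra.subset_adjoin (Or.inl hx)
  have hmem : ∀ (τ : R₃.toSubring), τ ∈ Ideal.comap (Subring.inclusion h3W) (maximalIdeal W) ↔
      W.valuation (τ : K) < 1 := by
    intro τ; rw [Ideal.mem_comap, ValuationSubring.valuation_lt_one_iff]; rfl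
  apply le_antisymm
  · rw [Ideal.span_le]
    rintro _ ⟨i, rfl⟩
    rw [SetLike.mem_coe, hmem]; exact hzW i
  · intro τ hτ
    rw [hmem] at hτ
    obtain ⟨b, hb, hbR, hτb⟩ := ap_exists_sub_mem_span B z R₃ hR₃ hzR τ τ.2
    -- `b` is `W`-small
    have hsmall : ∀ (σ : R₃.toSubring), σ ∈ Ideal.span (Set.range fun i => (⟨z i, hzR i⟩ : R₃.toSubring)) →
        W.valuation (σ : K) < 1 := by
      intro σ hσ
      rw [← hmem]
      refine (Ideal.span_le.mpr ?_) hσ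
      rintro _ ⟨i, rfl⟩; rw [SetLike.mem_coe, hmem]; exact hzW i
    have hbW : W.valuation b < 1 := by
      have h1 := hsmall _ hτb
      have : b = (τ : K) - ((τ : K) - b) := by ring
      rw [this]
      exact lt_of_le_of_lt (Valuation.map_sub _ _ _) (max_lt hτ h1)
    -- throw `b` into `(x_T)B` and divide
    obtain ⟨c, hc⟩ := Ideal.mem_span_range_iff_exists_fun.mp (hthrow b hb hbW)
    have hcK : (∑ i, (c i : K) * xT i) = Q ^ N₀ * b := by
      have := congrArg (fun t : B.toSubring => (t : K)) hc
      simp only [AddSubmonoidClass.coe_finsetSum, Subring.coe_mul] at this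
      exact this
    have hbz : b = ∑ i, ((c i : K) * E i) * z i := by
      have hQN : Q ^ N₀ ≠ 0 := pow_ne_zero _ hQ0
      have : b = (Q ^ N₀)⁻¹ * ∑ i, (c i : K) * xT i := by
        rw [hcK, ← mul_assoc, inv_mul_cancel₀ hQN, one_mul]
      rw [this, Finset.mul_sum]
      refine Finset.sum_congr rfl fun i _ => ?_
      rw [hz i]
      have hE0i := hE0 i
      field_simp
    have hbmem : (⟨b, hbR⟩ : R₃.toSubring) ∈ Ideal.span (Set.range fun i => (⟨z i, hzR i⟩ : R₃.toSubring)) := by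
      have : (⟨b, hbR⟩ : R₃.toSubring) =
          ∑ i, (⟨(c i : K) * E i, mul_mem (hBR (c i).2) (hBR (hE i))⟩ : R₃.toSubring) * ⟨z i, hzR i⟩ :=
        Subtype.ext (by push_cast; exact hbz)
      rw [this]
      exact Submodule.sum_mem _ fun i _ => Ideal.mul_mem_left _ _ (Ideal.subset_span ⟨i, rfl⟩)
    have : τ = ⟨(τ : K) - b, sub_mem τ.2 hbR⟩ + ⟨b, hbR⟩ := Subtype.ext (by push_cast; ring)
    rw [this]
    exact Ideal.add_mem _ hτb hbmem

/-! ### Laurent-monomial toolkit -/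

section Toolkit

variable {M : Type} [CommGroupWithZero M]

/-- A Laurent monomial in non-zero elements is non-zero. [folklore] -/
theorem ap_prod_zpow_ne_zero {r : ℕ} (y : Fin r → M) (hy : ∀ j, y j ≠ 0) (a : Fin r → ℤ) :
    (∏ j, y j ^ (a j)) ≠ 0 :=
  Finset.prod_ne_zero_iff.mpr fun j _ => zpow_ne_zero _ (hy j)

/-- Product of two Laurent monomials. [folklore] -/
theorem ap_prod_zpow_add {r : ℕ} (y : Fin r → M) (hy : ∀ j, y j ≠ 0) (a b : Fin r → ℤ) :
    (∏ j, y j ^ (a j)) * (∏ j, y j ^ (b j)) = ∏ j, y j ^ (a j + b j) := by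
  rw [← Finset.prod_mul_distrib]
  exact Finset.prod_congr rfl fun j _ => (zpow_add₀ (hy j) _ _).symm

/-- Power of a Laurent monomial. [folklore] -/
theorem ap_prod_zpow_zpow {r : ℕ} (y : Fin r → M) (a : Fin r → ℤ) (N : ℤ) :
    (∏ j, y j ^ (a j)) ^ N = ∏ j, y j ^ (N * a j) := by
  rw [← Finset.prod_zpow]
  exact Finset.prod_congr rfl fun j _ => by rw [← zpow_mul, mul_comm]

/-- `a ^ (∑ f) = ∏ a ^ f` for `a ≠ 0`. [folklore] -/
theorem ap_zpow_sum {ι : Type} (s : Finset ι) (a : M) (ha : a ≠ 0) (f : ι → ℤ) :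
    a ^ (∑ i ∈ s, f i) = ∏ i ∈ s, a ^ (f i) := by
  classical
  induction s using Finset.induction_on with
  | empty => simp
  | insert i s hi ih => rw [Finset.sum_insert hi, Finset.prod_insert hi, zpow_add₀ ha, ih]

/-- `(∏_j y_j^{C s j})` raised to `b s` and multiplied over `s` is the Laurent monomial with
exponents `∑_s b s * C s j`. [folklore] -/
theorem ap_prod_zpow_matrix {r q : ℕ} (y : Fin r → M) (hy : ∀ j, y j ≠ 0) (C : Fin q → Fin r → ℤ)
    (b : Fin q → ℤ) :
    (∏ s, (∏ j, y j ^ (C s j)) ^ (b s)) = ∏ j, y j ^ (∑ s, b s * C s j) := by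
  simp_rw [ap_prod_zpow_zpow]
  rw [Finset.prod_comm]
  exact Finset.prod_congr rfl fun j _ => (ap_zpow_sum _ _ (hy j) _).symm

/-- Natural exponents as integer exponents. [folklore] -/
theorem ap_prod_pow_eq_zpow {r : ℕ} (y : Fin r → M) (d : Fin r → ℕ) :
    (∏ j, y j ^ (d j)) = ∏ j, y j ^ ((d j : ℤ)) :=
  Finset.prod_congr rfl fun _ _ => (zpow_natCast _ _).symm

/-- Splitting a product over `Fin n` along the top / lower indices. [folklore] -/
theorem ap_prod_split {N : Type} [CommMonoid N] {n nT nS : ℕ} (lv : Fin n → ℕ) (top : ℕ)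
    (eT : Fin nT ≃ {i : Fin n // lv i = top}) (eS : Fin nS ≃ {i : Fin n // lv i < top})
    (hle : ∀ i, lv i ≤ top) (f : Fin n → N) :
    (∏ i, f i) = (∏ t, f (eT t)) * ∏ s, f (eS s) := by
  classical
  rw [← Fintype.prod_subtype_mul_prod_subtype (fun i => lv i = top)]
  congr 1
  · exact Fintype.prod_equiv eT.symm _ _ fun i => by simp
  · let e2 : {i : Fin n // ¬ lv i = top} ≃ {i : Fin n // lv i < top} :=
      Equiv.subtypeEquivRight fun i => ⟨fun h => lt_of_le_of_ne (hle i) h, fun h => h.ne⟩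
    exact Fintype.prod_equiv (e2.trans eS.symm) (fun i => f i) (fun s => f (eS s)) fun i => by
      simp only [Equiv.trans_apply, Equiv.apply_symm_apply]; rfl

/-- Equality of Laurent monomials with `ℤ`-independent values forces equality of exponents… for
VALUES: if `∏ τ^a = ∏ τ^b` and the `τ` are independent then `a = b`. [folklore] -/
theorem ap_exp_eq_of_prod_eq {r : ℕ} (τ : Fin r → M) (hτ : ∀ j, τ j ≠ 0)
    (hind : ∀ m : Fin r → ℤ, (∏ j, τ j ^ (m j)) = 1 → m = 0) (a b : Fin r → ℤ)
    (h : (∏ j, τ j ^ (a j)) = ∏ j, τ j ^ (b j)) : a = b := by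
  have h1 : (∏ j, τ j ^ ((a - b) j)) = 1 := by
    have : (∏ j, τ j ^ ((a - b) j)) = (∏ j, τ j ^ (a j)) * (∏ j, τ j ^ (b j))⁻¹ := by
      rw [← Finset.prod_inv_distrib, ← Finset.prod_mul_distrib]
      exact Finset.prod_congr rfl fun j _ => by rw [Pi.sub_apply, zpow_sub₀ (hτ j), div_eq_mul_inv]
    rw [this, h, mul_inv_cancel₀ (ap_prod_zpow_ne_zero τ hτ b)]
  exact sub_eq_zero.mp (hind _ h1)

end Toolkit


end Summit.ResolutionOfSingularities.ResolutionOfSingularities.Theorems.PfaffLine
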